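import Summits.PneNP.PneNP.Theorems.KarlinRubinMonotoneSufficesGreedyDefs

/-!
# Crux `MonotoneSuffices` (stmt-PneNP-18026), the GREEDY general detector — the trial as a layered circuit
# (definitions)

One trial (candidate table `c : Fin t → Fin M → Fin n`, threshold `θ`) is computed by a fan-in-2 circuit in
three phases on the wire type `E ⊕ σ`, `E` = edge slots of `Kₙ`, `σ = Fin t × Fin M` = one SELECTION bit per
(level, candidate index):

* `initW x` — the edge inputs, all selection bits off;
* `layerW c` — recompute every selection bit from the current wires: `newSelW c w (i, m)` says that candidate
  `c i m` is in the pool read off the selection bits of the levels `< i` (`inPoolW`, via `okLevelW`: "selected at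
  level `j` and adjacent", adjacency read off the edge wires by `adjW`) and no earlier candidate of row `i` is;
  iterating `t` times from `initW x` stabilises the bits level by level at the TRUE selections `selTrueW x c`
  (`pickIdx`: the index picked by the run of part 0 at each level);
* `cntBitW`, `verdictW c θ` — the verdict: every level has a selection, and at least `θ` non-candidates are
  adjacent to all selected candidates.

Definitions and unfolding lemmas only; sizes and semantics are proved in `KarlinRubinMonotoneSufficesGreedyCircuit*.lean`.
-/

set_option linter.dupNamespace false -- `Summit.PneNP.PneNP.…`: summit = sub-problem name (D-0017 single-conjunct layout)

namespace Summit.PneNP.PneNP.Theorems.MonotoneSuffices.Greedy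

open Finset
open Literature.Probability.RandomGraphs.PlantedClique

variable {n t M : ℕ}

/-! ### Reading adjacency off the edge wires -/

/-- The edge slot `s(v,u)` of `Kₙ` for `v ≠ u`. [folklore] -/
def edgeOf (v u : Fin n) (h : v ≠ u) : (⊤ : SimpleGraph (Fin n)).edgeSet :=
  ⟨s(v, u), (SimpleGraph.mem_edgeSet ⊤).2 ((SimpleGraph.top_adj v u).2 h)⟩

/-- Adjacency of `v` and `u` read off the edge wires (`false` on the diagonal). [folklore] -/
def adjW (w : (⊤ : SimpleGraph (Fin n)).edgeSet ⊕ (Fin t × Fin M) → Bool) (v u : Fin n) : Bool :=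
  if h : v = u then false else w (Sum.inl (edgeOf v u h))

/-- Adjacency read off the initial wires is adjacency in `x`. [folklore] -/
theorem adjW_inl (x : EdgeVec n) (s : Fin t × Fin M → Bool) (v u : Fin n) (h : v ≠ u) :
    adjW (Sum.elim x s) v u = x (edgeOf v u h) := by
  simp [adjW, h]

/-- No self-adjacency. [folklore] -/
theorem adjW_self (w : (⊤ : SimpleGraph (Fin n)).edgeSet ⊕ (Fin t × Fin M) → Bool) (v : Fin n) : adjW w v v = false := by
  simp [adjW]

/-! ### One layer -/

/-- Level `j` admits `v`: some candidate of row `j` is selected and adjacent to `v`. [folklore] -/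
def okLevelW (c : Fin t → Fin M → Fin n) (w : (⊤ : SimpleGraph (Fin n)).edgeSet ⊕ (Fin t × Fin M) → Bool)
    (j : Fin t) (v : Fin n) : Bool :=
  decide (∃ m' : Fin M, w (Sum.inr (j, m')) = true ∧ adjW w v (c j m') = true)

/-- `v` is in the pool of level `i` as read off the wires: admitted by every level `< i`. [folklore] -/
def inPoolW (c : Fin t → Fin M → Fin n) (w : (⊤ : SimpleGraph (Fin n)).edgeSet ⊕ (Fin t × Fin M) → Bool)
    (i : Fin t) (v : Fin n) : Bool :=
  decide (∀ j : Fin t, j.1 < i.1 → okLevelW c w j v = true)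

/-- The new selection bit of `(i, m)`: candidate `c i m` is in the pool of level `i` and no earlier candidate of
row `i` is. [folklore] -/
def newSelW (c : Fin t → Fin M → Fin n) (w : (⊤ : SimpleGraph (Fin n)).edgeSet ⊕ (Fin t × Fin M) → Bool)
    (p : Fin t × Fin M) : Bool :=
  inPoolW c w p.1 (c p.1 p.2) && decide (∀ m' : Fin M, m'.1 < p.2.1 → inPoolW c w p.1 (c p.1 m') = false)

/-- **One layer**: keep the edge wires, recompute all selection bits. [folklore] -/
def layerW (c : Fin t → Fin M → Fin n) (w : (⊤ : SimpleGraph (Fin n)).edgeSet ⊕ (Fin t × Fin M) → Bool) :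
    (⊤ : SimpleGraph (Fin n)).edgeSet ⊕ (Fin t × Fin M) → Bool :=
  Sum.elim (fun e => w (Sum.inl e)) (newSelW c w)

/-- The initial wires: the edge inputs and all selection bits off. [folklore] -/
def initW (x : EdgeVec n) : (⊤ : SimpleGraph (Fin n)).edgeSet ⊕ (Fin t × Fin M) → Bool :=
  Sum.elim x (fun _ => false)

/-- The layer keeps the edge wires. [folklore] -/
@[simp] theorem layerW_inl (c : Fin t → Fin M → Fin n) (w : (⊤ : SimpleGraph (Fin n)).edgeSet ⊕ (Fin t × Fin M) → Bool)
    (e : (⊤ : SimpleGraph (Fin n)).edgeSet) : layerW c w (Sum.inl e) = w (Sum.inl e) := rfl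

/-- The layer recomputes the selection bits. [folklore] -/
@[simp] theorem layerW_inr (c : Fin t → Fin M → Fin n) (w : (⊤ : SimpleGraph (Fin n)).edgeSet ⊕ (Fin t × Fin M) → Bool)
    (p : Fin t × Fin M) : layerW c w (Sum.inr p) = newSelW c w p := rfl

/-- The initial edge wires. [folklore] -/
@[simp] theorem initW_inl (x : EdgeVec n) (e : (⊤ : SimpleGraph (Fin n)).edgeSet) :
    (initW x : (⊤ : SimpleGraph (Fin n)).edgeSet ⊕ (Fin t × Fin M) → Bool) (Sum.inl e) = x e := rfl

/-- The initial selection bits are off. [folklore] -/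
@[simp] theorem initW_inr (x : EdgeVec n) (p : Fin t × Fin M) :
    (initW x : (⊤ : SimpleGraph (Fin n)).edgeSet ⊕ (Fin t × Fin M) → Bool) (Sum.inr p) = false := rfl

/-- Iterating the layer keeps the edge wires. [folklore] -/
theorem iterate_layerW_inl (c : Fin t → Fin M → Fin n) (x : EdgeVec n) (r : ℕ) (e : (⊤ : SimpleGraph (Fin n)).edgeSet) :
    ((layerW c)^[r] (initW x)) (Sum.inl e) = x e := by
  induction r with
  | zero => rfl
  | succ r ih => rw [Function.iterate_succ_apply', layerW_inl, ih]

/-! ### The verdict -/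

/-- The count bit of `u`: a non-candidate admitted by every level. [folklore] -/
def cntBitW (c : Fin t → Fin M → Fin n) (w : (⊤ : SimpleGraph (Fin n)).edgeSet ⊕ (Fin t × Fin M) → Bool) (u : Fin n) : Bool :=
  decide (u ∉ candSet c ∧ ∀ j : Fin t, okLevelW c w j u = true)

/-- **The verdict** read off the final wires: every level has a selected candidate, and at least `θ` count bits
are on. [folklore] -/
def verdictW (c : Fin t → Fin M → Fin n) (θ : ℕ) (w : (⊤ : SimpleGraph (Fin n)).edgeSet ⊕ (Fin t × Fin M) → Bool) : Bool :=
  decide ((∀ i : Fin t, ∃ m : Fin M, w (Sum.inr (i, m)) = true) ∧ θ ≤ #((univ : Finset (Fin n)).filter fun u => cntBitW c w u = true))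

/-! ### The true selections -/

/-- The candidate index picked at level `i` by the run (if the run is alive and some candidate is in the pool).
[folklore] -/
def pickIdx (x : EdgeVec n) (c : Fin t → Fin M → Fin n) (i : Fin t) : Option (Fin M) :=
  (run x c i.1).bind fun T => (List.finRange M).find? fun m => c i m ∈ pool x T

/-- The true selection bits. [folklore] -/
def selTrueW (x : EdgeVec n) (c : Fin t → Fin M → Fin n) (p : Fin t × Fin M) : Bool :=
  decide (pickIdx x c p.1 = some p.2)

/-- One level of the run in terms of the picked index. [folklore] -/
theorem run_succ_eq_pickIdx (x : EdgeVec n) (c : Fin t → Fin M → Fin n) (i : Fin t) :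
    run x c (i.1 + 1) = (run x c i.1).bind fun T => (pickIdx x c i).map fun m => insert (c i m) T := by
  rw [run_succ_of_lt x c i.2]
  cases h : run x c i.1 with
  | none => rfl
  | some T =>
      simp only [Option.bind_some, pickIdx, h, firstHit, Option.map_map]
      rfl

end Summit.PneNP.PneNP.Theorems.MonotoneSuffices.Greedy

namespace Summit.PneNP.PneNP.Theorems.MonotoneSuffices.Greedy

/-- Registered sub-goal `greedy_circuit_defs` of stmt-PneNP-18026 (greedy detector, circuit definitions file): the
edge slot of two distinct vertices (`edgeOf` unfolded). [folklore] -/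
theorem greedy_circuit_defs :
    ∀ {n : ℕ} (v u : Fin n), v ≠ u → (s(v, u) : Sym2 (Fin n)) ∈ (⊤ : SimpleGraph (Fin n)).edgeSet :=
  fun v u h => (edgeOf v u h).2

end Summit.PneNP.PneNP.Theorems.MonotoneSuffices.Greedy
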